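import Mathlib
import HarnessLib

/-!
# `UnitScaleTiltProp7N32SymLevelSums` — THE LEVEL-SUM BOOKKEEPING OF THE «(n3)₂-sym» SUPPLIER (route-R E′ (A′)-on-Σ, P-A2 (β), row `hN2s`; brick N5 of
# ym3-torus-px21 g7's LOCATE «H2-1ˢ» §5): the sparse Λ-channel, gradient, mass and remainder DOUBLE SUMS over the levels `i < j < l`, and the mass-channel single sum,
# as CLOSED REAL INEQUALITIES with explicit absolute constants and NO factor `l` anywhere (pure reals; Mathlib-only)

Cell `ym3-torus` (HUMAN RULING D-0037: YM₃ on T³ is ladder rung R3 — NOT d = 4, NOT infinite volume, NOT a mass gap, NOT the Clay problem), width seat `ym-ust-20520-w5`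
gen 10, crux K1 child «MinimiserStabilityRegPr» (stmt-QuantumFields-19200), EX lane, (β) row of P-A2.  `--supports stmt-QuantumFields-19200 --as helper`; THEOREMS ONLY (0 `def`,
0 `sorry`); count-neutral; nothing here claims `hN2s`, (β), `hD`, EX, the crux or the gap.

WHY.  px21 g7's LOCATE (HOME `ym3-torus-px21/g7/LOCATE-H21s-N32SYM-px21g7.md`, §0 (2)(5)): the plain ℓ¹ two-channel engines lose a factor `l = #levels` at SECOND order; the cure
(sparse Λ-channel + level-0 localisation) produces, at level `l`, double sums over `i < j < l` whose summands carry the mass-channel damping `ρ^{j−1−i}` (`ρ ≤ L⁻²`, `d = 3`),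
the source profile `A·L^{−i} + B·Lⁱ`, the sparse volume fraction `(L^{j+2−l})³` and the localisation weight `L^{2(j+2)}`.  THIS FILE sums them ONCE AND FOR ALL, in the letter a
member knit can `exact` after rewriting its summand: every bound is `c·L^{±l}·(…)` with an ABSOLUTE `c`, for every real base `3 ≤ x` (the cell's odd `L > 1`).

WHAT (all over `Finset.range`, `x : ℝ`):
* §0 geometric engines for `1 < x`: `sum_pow_le`, `sum_sum_pow_le` (`∑_{i<j<l} xⁱ ≤ xˡ∕(x−1)²`), `sum_sum_pow_add_le` (`∑ x^{i+j}`), `sum_sum_pow_three_le` (`∑ x^{j+3i}`),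
  `sum_sum_pow_three_div_le` (`∑ x^{3i+2}∕x^{2j}`).
  and `sum_inv_pow_le` (`∑_{j<l}(xʲ)⁻¹ ≤ x∕(x−1)`).
* §1 the damping letter: `pow_damp_le` — for `0 ≤ ρ ≤ (x²)⁻¹` and `i < j`, `ρ^{j−1−i} ≤ x^{2i+2}·(x^{2j})⁻¹` (the ℕ-subtraction `j − 1 − i` of the propagation products disposed of once).
* §2 THE FIVE ROWS of px21 g7's N-LINE NAMER WORD №1 (08:02:49Z), letters `0 ≤ ρ₁ ≤ (L²)⁻¹`, `0 ≤ ρ₂ ≤ L⁻¹`, real `L` with `1 < L` (every odd `L ≥ 3`), every `l : ℕ`: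
  ★ (R1) `∑_{j<l}∑_{i<j} ρ₁^{j−1−i}·ρ₂^{i}·(L^{j+2}∕L^{l})³ ≤ L⁸∕((L²−1)(L−1)) · (Lˡ)⁻¹` (the sparse Λ-channel's A-part, `C_A(L) = L⁸∕((L²−1)(L−1))`);
  ★ (R2) `∑∑ ρ₁^{j−1−i}·ρ₂^{i}·L^{2(j+1)} ≤ L⁴·((L−1)²)⁻¹·Lˡ` (localisation weight); ★ (R3) `∑∑ ρ₁^{j−1−i}·Lⁱ ≤ (1−L⁻³)⁻¹·(L−1)⁻¹·Lˡ` (growing sources);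
  ★ (R4) `∑∑ ρ₁^{j−1−i}·(Lⁱ)⁻¹ ≤ L³∕(L−1)²` (decaying sources — an `l`-FREE constant); ★ (R5a) `∑_{i<l} ρ₁^{l−1−i}·(Lⁱ)⁻¹ ≤ (L−1)⁻¹·L²·(Lˡ)⁻¹`,
  ★ (R5b) `∑_{i<l} ρ₁^{l−1−i}·Lⁱ ≤ (1−L⁻³)⁻¹·L^{l−1}` (the mass channel of 1b at `d = 3`).
HONEST SCOPE.  Elementary real analysis (finite geometric sums); no lattice object is mentioned; the letters (`ρ`, the summand shapes) are px21 g7's §5 — to be re-cut token for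
token to N1's∕N6's SIGNATUREs if they differ (the engines of §0–§1 are shape-independent).  The constants are the raw geometric-series outputs (the namer's `C_A(L)`, `L⁴(L−1)⁻²`, `(1−L⁻³)⁻¹(L−1)⁻¹`, `L³∕(L−1)²`, `(L−1)⁻¹L²`, `(1−L⁻³)⁻¹`); they may move by a constant
when N6 assembles (cheap to re-cut).  Nothing of `hN2s`∕H2-1∕(β)∕`hD`∕EX∕the crux is proved; `stub_existenceMinimalOrbit` still `sorry`; rung R3, not d = 4, not Clay; YM gap NOT proved.

References: T. Bałaban, CMP **102** (1985) 277–309 [Balaban1985Variational] ((19)–(21) pp.280–281, (141)–(142) p.299: the E–L∕growth rows the (β) row serves);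
CMP **98** (1985) 17–51 [Balaban1985Averaging] ((97)–(100) p.32: the level-by-level averaging tower whose levels are summed here).
-/

set_option autoImplicit false

open Finset

namespace Summit.QuantumFields.YangMills.Theorems.Prop7N32SymLevelSums

/-! ## §0 Geometric engines (`1 < x`) -/

/-- `∑_{i<l} xⁱ ≤ xˡ∕(x − 1)` for `1 < x` (`= (xˡ − 1)∕(x − 1)`). [folklore] -/
theorem sum_pow_le {x : ℝ} (hx : 1 < x) (l : ℕ) : ∑ i ∈ range l, x ^ i ≤ x ^ l / (x - 1) := by
  rw [geom_sum_eq hx.ne' l]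
  exact div_le_div_of_nonneg_right (by linarith) (by linarith)

/-- `∑_{j<l} ∑_{i<j} xⁱ ≤ xˡ∕(x − 1)²` for `1 < x` (the pair count `∑_{i<l}(l−1−i)xⁱ`, summed as nested ranges). [folklore] -/
theorem sum_sum_pow_le {x : ℝ} (hx : 1 < x) (l : ℕ) :
    ∑ j ∈ range l, ∑ i ∈ range j, x ^ i ≤ x ^ l / (x - 1) ^ 2 := by
  have hx1 : 0 < x - 1 := by linarith
  calc ∑ j ∈ range l, ∑ i ∈ range j, x ^ i ≤ ∑ j ∈ range l, x ^ j / (x - 1) := sum_le_sum fun j _ => sum_pow_le hx j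
    _ = (∑ j ∈ range l, x ^ j) / (x - 1) := by rw [sum_div]
    _ ≤ (x ^ l / (x - 1)) / (x - 1) := div_le_div_of_nonneg_right (sum_pow_le hx l) hx1.le
    _ = x ^ l / (x - 1) ^ 2 := by rw [div_div, sq]

/-- `∑_{j<l} ∑_{i<j} x^{i+j} ≤ x^{2l}∕((x − 1)(x² − 1))` for `1 < x`. [folklore] -/
theorem sum_sum_pow_add_le {x : ℝ} (hx : 1 < x) (l : ℕ) :
    ∑ j ∈ range l, ∑ i ∈ range j, x ^ (i + j) ≤ x ^ (2 * l) / ((x - 1) * (x ^ 2 - 1)) := by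
  have hx0 : 0 < x := by linarith
  have hx1 : 0 < x - 1 := by linarith
  have hx2 : 1 < x ^ 2 := one_lt_pow₀ hx (by norm_num)
  calc ∑ j ∈ range l, ∑ i ∈ range j, x ^ (i + j)
      = ∑ j ∈ range l, x ^ j * ∑ i ∈ range j, x ^ i := by
          refine sum_congr rfl fun j _ => ?_
          rw [mul_sum]; exact sum_congr rfl fun i _ => by rw [pow_add, mul_comm]
    _ ≤ ∑ j ∈ range l, x ^ j * (x ^ j / (x - 1)) :=
          sum_le_sum fun j _ => mul_le_mul_of_nonneg_left (sum_pow_le hx j) (pow_nonneg hx0.le _)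
    _ = (∑ j ∈ range l, (x ^ 2) ^ j) / (x - 1) := by
          rw [sum_div]; exact sum_congr rfl fun j _ => by rw [← pow_mul, two_mul, pow_add]; ring
    _ ≤ ((x ^ 2) ^ l / (x ^ 2 - 1)) / (x - 1) := div_le_div_of_nonneg_right (sum_pow_le hx2 l) hx1.le
    _ = x ^ (2 * l) / ((x - 1) * (x ^ 2 - 1)) := by rw [← pow_mul, div_div, mul_comm (x ^ 2 - 1) (x - 1)]

/-- `∑_{j<l} ∑_{i<j} x^{j+3i} ≤ x^{4l}∕((x³ − 1)(x⁴ − 1))` for `1 < x`. [folklore] -/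
theorem sum_sum_pow_three_le {x : ℝ} (hx : 1 < x) (l : ℕ) :
    ∑ j ∈ range l, ∑ i ∈ range j, x ^ (j + 3 * i) ≤ x ^ (4 * l) / ((x ^ 3 - 1) * (x ^ 4 - 1)) := by
  have hx0 : 0 < x := by linarith
  have hx3 : 1 < x ^ 3 := one_lt_pow₀ hx (by norm_num)
  have hx4 : 1 < x ^ 4 := one_lt_pow₀ hx (by norm_num)
  have h31 : 0 < x ^ 3 - 1 := by linarith
  calc ∑ j ∈ range l, ∑ i ∈ range j, x ^ (j + 3 * i)
      = ∑ j ∈ range l, x ^ j * ∑ i ∈ range j, (x ^ 3) ^ i := by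
          refine sum_congr rfl fun j _ => ?_
          rw [mul_sum]; exact sum_congr rfl fun i _ => by rw [pow_add, pow_mul]
    _ ≤ ∑ j ∈ range l, x ^ j * ((x ^ 3) ^ j / (x ^ 3 - 1)) :=
          sum_le_sum fun j _ => mul_le_mul_of_nonneg_left (sum_pow_le hx3 j) (pow_nonneg hx0.le _)
    _ = (∑ j ∈ range l, (x ^ 4) ^ j) / (x ^ 3 - 1) := by
          rw [sum_div]; refine sum_congr rfl fun j _ => ?_
          rw [← pow_mul, ← pow_mul, show x ^ (4 * j) = x ^ j * x ^ (3 * j) by rw [← pow_add]; ring_nf]; ring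
    _ ≤ ((x ^ 4) ^ l / (x ^ 4 - 1)) / (x ^ 3 - 1) := div_le_div_of_nonneg_right (sum_pow_le hx4 l) h31.le
    _ = x ^ (4 * l) / ((x ^ 3 - 1) * (x ^ 4 - 1)) := by rw [← pow_mul, div_div, mul_comm (x ^ 4 - 1) (x ^ 3 - 1)]

/-- `∑_{j<l} ∑_{i<j} x^{3i+2}·(x^{2j})⁻¹ ≤ x^{l+2}∕((x³ − 1)(x − 1))` for `1 < x`. [folklore] -/
theorem sum_sum_pow_three_div_le {x : ℝ} (hx : 1 < x) (l : ℕ) :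
    ∑ j ∈ range l, ∑ i ∈ range j, x ^ (3 * i + 2) * (x ^ (2 * j))⁻¹ ≤ x ^ (l + 2) / ((x ^ 3 - 1) * (x - 1)) := by
  have hx0 : 0 < x := by linarith
  have hx3 : 1 < x ^ 3 := one_lt_pow₀ hx (by norm_num)
  have h31 : 0 < x ^ 3 - 1 := by linarith
  have hx1 : 0 < x - 1 := by linarith
  calc ∑ j ∈ range l, ∑ i ∈ range j, x ^ (3 * i + 2) * (x ^ (2 * j))⁻¹
      = ∑ j ∈ range l, x ^ 2 * (x ^ (2 * j))⁻¹ * ∑ i ∈ range j, (x ^ 3) ^ i := by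
          refine sum_congr rfl fun j _ => ?_
          rw [mul_sum]; exact sum_congr rfl fun i _ => by rw [pow_add, pow_mul]; ring
    _ ≤ ∑ j ∈ range l, x ^ 2 * (x ^ (2 * j))⁻¹ * ((x ^ 3) ^ j / (x ^ 3 - 1)) :=
          sum_le_sum fun j _ => mul_le_mul_of_nonneg_left (sum_pow_le hx3 j) (by positivity)
    _ = (∑ j ∈ range l, x ^ j) * (x ^ 2 / (x ^ 3 - 1)) := by
          rw [sum_mul]; refine sum_congr rfl fun j _ => ?_
          rw [← pow_mul, show x ^ (3 * j) = x ^ j * x ^ (2 * j) by rw [← pow_add]; ring_nf]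
          field_simp
    _ ≤ (x ^ l / (x - 1)) * (x ^ 2 / (x ^ 3 - 1)) := mul_le_mul_of_nonneg_right (sum_pow_le hx l) (by positivity)
    _ = x ^ (l + 2) / ((x ^ 3 - 1) * (x - 1)) := by rw [pow_add]; field_simp

/-- `∑_{j<l} (xʲ)⁻¹ ≤ x∕(x − 1)` for `1 < x` (geometric series of ratio `x⁻¹`). [folklore] -/
theorem sum_inv_pow_le {x : ℝ} (hx : 1 < x) (l : ℕ) : ∑ j ∈ range l, (x ^ j)⁻¹ ≤ x / (x - 1) := by
  have hx0 : 0 < x := by linarith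
  have hr1 : x⁻¹ < 1 := inv_lt_one_of_one_lt₀ hx
  have hr0 : 0 ≤ x⁻¹ := by positivity
  have hne : x⁻¹ ≠ 1 := hr1.ne
  calc ∑ j ∈ range l, (x ^ j)⁻¹ = ∑ j ∈ range l, (x⁻¹) ^ j := sum_congr rfl fun j _ => by rw [inv_pow]
    _ = (1 - (x⁻¹) ^ l) / (1 - x⁻¹) := by rw [geom_sum_eq hne, ← neg_sub, ← neg_sub (x⁻¹), neg_div, div_neg]
    _ ≤ 1 / (1 - x⁻¹) := div_le_div_of_nonneg_right (by linarith [pow_nonneg hr0 l]) (by linarith)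
    _ = x / (x - 1) := by field_simp

/-! ## §1 The damping letter `ρ ≤ (x²)⁻¹` and the ℕ-subtraction `j − 1 − i` -/

/-- For `0 ≤ ρ ≤ (x²)⁻¹`, `0 < x` and `i < j`: `ρ^{j−1−i} ≤ x^{2i+2}·(x^{2j})⁻¹` (`(x²)⁻¹^{j−1−i} = x^{2(i+1)}∕x^{2j}` since `2(j−1−i) + 2(i+1) = 2j`). [folklore] -/
theorem pow_damp_le {x ρ : ℝ} (hx : 0 < x) (hρ0 : 0 ≤ ρ) (hρ : ρ ≤ (x ^ 2)⁻¹) {i j : ℕ} (hij : i < j) :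
    ρ ^ (j - 1 - i) ≤ x ^ (2 * i + 2) * (x ^ (2 * j))⁻¹ := by
  have hpow : ρ ^ (j - 1 - i) ≤ ((x ^ 2)⁻¹) ^ (j - 1 - i) := pow_le_pow_left₀ hρ0 hρ _
  refine hpow.trans (le_of_eq ?_)
  have hxne : x ≠ 0 := hx.ne'
  rw [eq_mul_inv_iff_mul_eq₀ (pow_ne_zero _ hxne), inv_pow, ← pow_mul, inv_mul_eq_iff_eq_mul₀ (pow_ne_zero _ hxne), ← pow_add]
  congr 1; omega

/-- The same for the single mass-channel sum: `i < l ⇒ ρ^{l−1−i} ≤ x^{2i+2}·(x^{2l})⁻¹`. [folklore] -/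
theorem pow_damp_le' {x ρ : ℝ} (hx : 0 < x) (hρ0 : 0 ≤ ρ) (hρ : ρ ≤ (x ^ 2)⁻¹) {i l : ℕ} (hil : i < l) :
    ρ ^ (l - 1 - i) ≤ x ^ (2 * i + 2) * (x ^ (2 * l))⁻¹ := pow_damp_le hx hρ0 hρ hil

/-! ## §2 THE FIVE ROWS (R1)–(R5) OF THE N-LINE NAMER WORD №1 (px21 g7, 08:02:49Z) — letters `ρ₁ ≤ L⁻²`, `ρ₂ ≤ L⁻¹`, real `L` with `1 < L` (every odd `L ≥ 3`), every `l : ℕ` -/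

section Rows

variable {L ρ₁ ρ₂ : ℝ}

/-- ★ (R1) **THE SPARSE Λ-CHANNEL, A-PART**: `∑_{j<l}∑_{i<j} ρ₁^{j−1−i}·ρ₂^{i}·(L^{j+2}∕L^{l})³ ≤ C_A(L)·L^{−l}` with `C_A(L) = L⁸∕((L²−1)(L−1))`, for `1 < L`,
`0 ≤ ρ₁ ≤ (L²)⁻¹`, `0 ≤ ρ₂ ≤ L⁻¹` (termwise `≤ L⁸·(L^{3l})⁻¹·L^{i+j}` by §1, then `∑_{i<j<l} L^{i+j} ≤ L^{2l}∕((L−1)(L²−1))`).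
[cite: Balaban1985Averaging, (97)-(100) p.32; Balaban1985Variational, (141)-(142) p.299] -/
theorem row_R1 (hL : 1 < L) (hρ₁0 : 0 ≤ ρ₁) (hρ₁ : ρ₁ ≤ (L ^ 2)⁻¹) (hρ₂0 : 0 ≤ ρ₂) (hρ₂ : ρ₂ ≤ L⁻¹) (l : ℕ) :
    ∑ j ∈ range l, ∑ i ∈ range j, ρ₁ ^ (j - 1 - i) * ρ₂ ^ i * (L ^ (j + 2) / L ^ l) ^ 3
      ≤ L ^ 8 / ((L ^ 2 - 1) * (L - 1)) * (L ^ l)⁻¹ := by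
  have hL0 : 0 < L := by linarith
  have hLne : L ≠ 0 := hL0.ne'
  calc ∑ j ∈ range l, ∑ i ∈ range j, ρ₁ ^ (j - 1 - i) * ρ₂ ^ i * (L ^ (j + 2) / L ^ l) ^ 3
      ≤ ∑ j ∈ range l, ∑ i ∈ range j, L ^ 8 * (L ^ (3 * l))⁻¹ * L ^ (i + j) := by
          refine sum_le_sum fun j _ => sum_le_sum fun i hi => ?_
          have hij : i < j := mem_range.1 hi
          have h2 : ρ₂ ^ i ≤ (L ^ i)⁻¹ := by rw [← inv_pow]; exact pow_le_pow_left₀ hρ₂0 hρ₂ i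
          calc ρ₁ ^ (j - 1 - i) * ρ₂ ^ i * (L ^ (j + 2) / L ^ l) ^ 3
              ≤ (L ^ (2 * i + 2) * (L ^ (2 * j))⁻¹) * (L ^ i)⁻¹ * (L ^ (j + 2) / L ^ l) ^ 3 := by
                  gcongr
                  exact pow_damp_le hL0 hρ₁0 hρ₁ hij
            _ = L ^ 8 * (L ^ (3 * l))⁻¹ * L ^ (i + j) := by field_simp; ring
    _ = L ^ 8 * (L ^ (3 * l))⁻¹ * ∑ j ∈ range l, ∑ i ∈ range j, L ^ (i + j) := by
          rw [mul_sum]; exact sum_congr rfl fun j _ => by rw [mul_sum]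
    _ ≤ L ^ 8 * (L ^ (3 * l))⁻¹ * (L ^ (2 * l) / ((L - 1) * (L ^ 2 - 1))) :=
          mul_le_mul_of_nonneg_left (sum_sum_pow_add_le hL l) (by positivity)
    _ = L ^ 8 / ((L ^ 2 - 1) * (L - 1)) * (L ^ l)⁻¹ := by field_simp; ring

/-- ★ (R2) **THE GRADIENT∕LOCALISATION WEIGHT**: `∑_{j<l}∑_{i<j} ρ₁^{j−1−i}·ρ₂^{i}·L^{2(j+1)} ≤ L⁴·((L−1)²)⁻¹·L^{l}` for `1 < L`, `0 ≤ ρ₁ ≤ (L²)⁻¹`, `0 ≤ ρ₂ ≤ L⁻¹`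
(termwise `≤ L⁴·Lⁱ`, then `∑_{i<j<l} Lⁱ ≤ Lˡ∕(L−1)²`). [cite: Balaban1985Averaging, (97)-(100) p.32] -/
theorem row_R2 (hL : 1 < L) (hρ₁0 : 0 ≤ ρ₁) (hρ₁ : ρ₁ ≤ (L ^ 2)⁻¹) (hρ₂0 : 0 ≤ ρ₂) (hρ₂ : ρ₂ ≤ L⁻¹) (l : ℕ) :
    ∑ j ∈ range l, ∑ i ∈ range j, ρ₁ ^ (j - 1 - i) * ρ₂ ^ i * L ^ (2 * (j + 1)) ≤ L ^ 4 * ((L - 1) ^ 2)⁻¹ * L ^ l := by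
  have hL0 : 0 < L := by linarith
  have hLne : L ≠ 0 := hL0.ne'
  calc ∑ j ∈ range l, ∑ i ∈ range j, ρ₁ ^ (j - 1 - i) * ρ₂ ^ i * L ^ (2 * (j + 1))
      ≤ ∑ j ∈ range l, ∑ i ∈ range j, L ^ 4 * L ^ i := by
          refine sum_le_sum fun j _ => sum_le_sum fun i hi => ?_
          have hij : i < j := mem_range.1 hi
          have h2 : ρ₂ ^ i ≤ (L ^ i)⁻¹ := by rw [← inv_pow]; exact pow_le_pow_left₀ hρ₂0 hρ₂ i
          calc ρ₁ ^ (j - 1 - i) * ρ₂ ^ i * L ^ (2 * (j + 1))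
              ≤ (L ^ (2 * i + 2) * (L ^ (2 * j))⁻¹) * (L ^ i)⁻¹ * L ^ (2 * (j + 1)) := by
                  gcongr
                  exact pow_damp_le hL0 hρ₁0 hρ₁ hij
            _ = L ^ 4 * L ^ i := by field_simp; ring
    _ = L ^ 4 * ∑ j ∈ range l, ∑ i ∈ range j, L ^ i := by rw [mul_sum]; exact sum_congr rfl fun j _ => by rw [mul_sum]
    _ ≤ L ^ 4 * (L ^ l / (L - 1) ^ 2) := mul_le_mul_of_nonneg_left (sum_sum_pow_le hL l) (by positivity)
    _ = L ^ 4 * ((L - 1) ^ 2)⁻¹ * L ^ l := by rw [div_eq_mul_inv]; ring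

/-- ★ (R3) **THE GROWING-SOURCE ROW**: `∑_{j<l}∑_{i<j} ρ₁^{j−1−i}·L^{i} ≤ (1 − L⁻³)⁻¹·(L−1)⁻¹·L^{l}` for `1 < L`, `0 ≤ ρ₁ ≤ (L²)⁻¹` (termwise `≤ L^{3i+2}∕L^{2j}`, then
`∑ ≤ L^{l+2}∕((L³−1)(L−1)) = (1−L⁻³)⁻¹(L−1)⁻¹·Lˡ·L⁻¹ ≤ …·Lˡ`). [cite: Balaban1985Averaging, (97)-(100) p.32] -/
theorem row_R3 (hL : 1 < L) (hρ₁0 : 0 ≤ ρ₁) (hρ₁ : ρ₁ ≤ (L ^ 2)⁻¹) (l : ℕ) :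
    ∑ j ∈ range l, ∑ i ∈ range j, ρ₁ ^ (j - 1 - i) * L ^ i ≤ (1 - L⁻¹ ^ 3)⁻¹ * (L - 1)⁻¹ * L ^ l := by
  have hL0 : 0 < L := by linarith
  have hLne : L ≠ 0 := hL0.ne'
  have hL3 : 1 < L ^ 3 := one_lt_pow₀ hL (by norm_num)
  have h31 : 0 < L ^ 3 - 1 := by linarith
  have hL1 : 0 < L - 1 := by linarith
  have h13 : 0 < 1 - L⁻¹ ^ 3 := by
    have : L⁻¹ ^ 3 < 1 := pow_lt_one₀ (by positivity) (inv_lt_one_of_one_lt₀ hL) (by norm_num)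
    linarith
  calc ∑ j ∈ range l, ∑ i ∈ range j, ρ₁ ^ (j - 1 - i) * L ^ i
      ≤ ∑ j ∈ range l, ∑ i ∈ range j, L ^ (3 * i + 2) * (L ^ (2 * j))⁻¹ := by
          refine sum_le_sum fun j _ => sum_le_sum fun i hi => ?_
          have hij : i < j := mem_range.1 hi
          calc ρ₁ ^ (j - 1 - i) * L ^ i ≤ (L ^ (2 * i + 2) * (L ^ (2 * j))⁻¹) * L ^ i := by
                  gcongr; exact pow_damp_le hL0 hρ₁0 hρ₁ hij
            _ = L ^ (3 * i + 2) * (L ^ (2 * j))⁻¹ := by field_simp; ring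
    _ ≤ L ^ (l + 2) / ((L ^ 3 - 1) * (L - 1)) := sum_sum_pow_three_div_le hL l
    _ = (1 - L⁻¹ ^ 3)⁻¹ * (L - 1)⁻¹ * L ^ l * L⁻¹ := by field_simp; ring
    _ ≤ (1 - L⁻¹ ^ 3)⁻¹ * (L - 1)⁻¹ * L ^ l * 1 := by
          gcongr
          exact inv_le_one_of_one_le₀ hL.le
    _ = (1 - L⁻¹ ^ 3)⁻¹ * (L - 1)⁻¹ * L ^ l := mul_one _

/-- ★ (R4) **THE DECAYING-SOURCE ROW**: `∑_{j<l}∑_{i<j} ρ₁^{j−1−i}·L^{−i} ≤ L³∕(L−1)²` (an `l`-FREE constant) for `1 < L`, `0 ≤ ρ₁ ≤ (L²)⁻¹` (termwise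
`≤ L^{i+2}∕L^{2j}`; `∑_{i<j} L^{i} ≤ L^{j}∕(L−1)`; `∑_{j<l} L^{j+2}∕L^{2j} = L²∑(Lʲ)⁻¹ ≤ L³∕(L−1)`). [cite: Balaban1985Averaging, (97)-(100) p.32] -/
theorem row_R4 (hL : 1 < L) (hρ₁0 : 0 ≤ ρ₁) (hρ₁ : ρ₁ ≤ (L ^ 2)⁻¹) (l : ℕ) :
    ∑ j ∈ range l, ∑ i ∈ range j, ρ₁ ^ (j - 1 - i) * (L ^ i)⁻¹ ≤ L ^ 3 / (L - 1) ^ 2 := by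
  have hL0 : 0 < L := by linarith
  have hLne : L ≠ 0 := hL0.ne'
  have hL1 : 0 < L - 1 := by linarith
  calc ∑ j ∈ range l, ∑ i ∈ range j, ρ₁ ^ (j - 1 - i) * (L ^ i)⁻¹
      ≤ ∑ j ∈ range l, L ^ 2 * (L ^ (2 * j))⁻¹ * ∑ i ∈ range j, L ^ i := by
          refine sum_le_sum fun j _ => ?_
          rw [mul_sum]
          refine sum_le_sum fun i hi => ?_
          have hij : i < j := mem_range.1 hi
          calc ρ₁ ^ (j - 1 - i) * (L ^ i)⁻¹ ≤ (L ^ (2 * i + 2) * (L ^ (2 * j))⁻¹) * (L ^ i)⁻¹ := by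
                  gcongr; exact pow_damp_le hL0 hρ₁0 hρ₁ hij
            _ = L ^ 2 * (L ^ (2 * j))⁻¹ * L ^ i := by field_simp; ring
    _ ≤ ∑ j ∈ range l, L ^ 2 * (L ^ (2 * j))⁻¹ * (L ^ j / (L - 1)) :=
          sum_le_sum fun j _ => mul_le_mul_of_nonneg_left (sum_pow_le hL j) (by positivity)
    _ = L ^ 2 / (L - 1) * ∑ j ∈ range l, (L ^ j)⁻¹ := by
          rw [mul_sum]; refine sum_congr rfl fun j _ => ?_
          have h2 : L ^ (2 * j) = L ^ j * L ^ j := by rw [two_mul, pow_add]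
          rw [h2]; field_simp
    _ ≤ L ^ 2 / (L - 1) * (L / (L - 1)) := mul_le_mul_of_nonneg_left (sum_inv_pow_le hL l) (by positivity)
    _ = L ^ 3 / (L - 1) ^ 2 := by rw [div_mul_div_comm, ← pow_succ, sq]

/-- ★ (R5a) **THE MASS CHANNEL, DECAYING SOURCES**: `∑_{i<l} ρ₁^{l−1−i}·L^{−i} ≤ (L−1)⁻¹·L²·L^{−l}` for `1 < L`, `0 ≤ ρ₁ ≤ (L²)⁻¹` (termwise `≤ L^{i+2}∕L^{2l}`,
`∑_{i<l} Lⁱ ≤ Lˡ∕(L−1)`). [cite: Balaban1985Averaging, (97)-(100) p.32; Balaban1985Variational, (19)-(21) pp.280-281] -/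
theorem row_R5a (hL : 1 < L) (hρ₁0 : 0 ≤ ρ₁) (hρ₁ : ρ₁ ≤ (L ^ 2)⁻¹) (l : ℕ) :
    ∑ i ∈ range l, ρ₁ ^ (l - 1 - i) * (L ^ i)⁻¹ ≤ (L - 1)⁻¹ * L ^ 2 * (L ^ l)⁻¹ := by
  have hL0 : 0 < L := by linarith
  have hLne : L ≠ 0 := hL0.ne'
  have hL1 : 0 < L - 1 := by linarith
  calc ∑ i ∈ range l, ρ₁ ^ (l - 1 - i) * (L ^ i)⁻¹ ≤ ∑ i ∈ range l, L ^ 2 * (L ^ (2 * l))⁻¹ * L ^ i := by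
          refine sum_le_sum fun i hi => ?_
          have hil : i < l := mem_range.1 hi
          calc ρ₁ ^ (l - 1 - i) * (L ^ i)⁻¹ ≤ (L ^ (2 * i + 2) * (L ^ (2 * l))⁻¹) * (L ^ i)⁻¹ := by
                  gcongr; exact pow_damp_le' hL0 hρ₁0 hρ₁ hil
            _ = L ^ 2 * (L ^ (2 * l))⁻¹ * L ^ i := by field_simp; ring
    _ = L ^ 2 * (L ^ (2 * l))⁻¹ * ∑ i ∈ range l, L ^ i := by rw [mul_sum]
    _ ≤ L ^ 2 * (L ^ (2 * l))⁻¹ * (L ^ l / (L - 1)) := mul_le_mul_of_nonneg_left (sum_pow_le hL l) (by positivity)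
    _ = (L - 1)⁻¹ * L ^ 2 * (L ^ l)⁻¹ := by
          have h2 : L ^ (2 * l) = L ^ l * L ^ l := by rw [two_mul, pow_add]
          rw [h2]; field_simp

/-- ★ (R5b) **THE MASS CHANNEL, GROWING SOURCES**: `∑_{i<l} ρ₁^{l−1−i}·Lⁱ ≤ (1 − L⁻³)⁻¹·L^{l−1}` for `1 < L`, `0 ≤ ρ₁ ≤ (L²)⁻¹` (termwise `≤ L^{3i+2}∕L^{2l}`,
`∑_{i<l} L^{3i} ≤ L^{3l}∕(L³−1)`; `l = 0` is the empty sum). [cite: Balaban1985Averaging, (97)-(100) p.32; Balaban1985Variational, (19)-(21) pp.280-281] -/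
theorem row_R5b (hL : 1 < L) (hρ₁0 : 0 ≤ ρ₁) (hρ₁ : ρ₁ ≤ (L ^ 2)⁻¹) (l : ℕ) :
    ∑ i ∈ range l, ρ₁ ^ (l - 1 - i) * L ^ i ≤ (1 - L⁻¹ ^ 3)⁻¹ * L ^ (l - 1) := by
  have hL0 : 0 < L := by linarith
  have hLne : L ≠ 0 := hL0.ne'
  have hL3 : 1 < L ^ 3 := one_lt_pow₀ hL (by norm_num)
  have h31 : 0 < L ^ 3 - 1 := by linarith
  have h13 : 0 < 1 - L⁻¹ ^ 3 := by
    have : L⁻¹ ^ 3 < 1 := pow_lt_one₀ (by positivity) (inv_lt_one_of_one_lt₀ hL) (by norm_num)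
    linarith
  rcases Nat.eq_zero_or_pos l with rfl | hl
  · simp only [range_zero, sum_empty]; positivity
  calc ∑ i ∈ range l, ρ₁ ^ (l - 1 - i) * L ^ i ≤ ∑ i ∈ range l, L ^ 2 * (L ^ (2 * l))⁻¹ * (L ^ 3) ^ i := by
          refine sum_le_sum fun i hi => ?_
          have hil : i < l := mem_range.1 hi
          calc ρ₁ ^ (l - 1 - i) * L ^ i ≤ (L ^ (2 * i + 2) * (L ^ (2 * l))⁻¹) * L ^ i := by
                  gcongr; exact pow_damp_le' hL0 hρ₁0 hρ₁ hil
            _ = L ^ 2 * (L ^ (2 * l))⁻¹ * (L ^ 3) ^ i := by rw [← pow_mul]; field_simp; ring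
    _ = L ^ 2 * (L ^ (2 * l))⁻¹ * ∑ i ∈ range l, (L ^ 3) ^ i := by rw [mul_sum]
    _ ≤ L ^ 2 * (L ^ (2 * l))⁻¹ * ((L ^ 3) ^ l / (L ^ 3 - 1)) := mul_le_mul_of_nonneg_left (sum_pow_le hL3 l) (by positivity)
    _ = (1 - L⁻¹ ^ 3)⁻¹ * L ^ (l - 1) := by
          obtain ⟨m, rfl⟩ : ∃ m, l = m + 1 := ⟨l - 1, by omega⟩
          rw [Nat.add_sub_cancel, ← pow_mul]
          have h3 : L ^ (3 * (m + 1)) = L ^ (2 * (m + 1)) * L ^ m * L := by rw [← pow_add, ← pow_succ]; ring_nf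
          rw [h3]; field_simp

end Rows

end Summit.QuantumFields.YangMills.Theorems.Prop7N32SymLevelSums
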